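/-
Copyright (c) 2026 the pub-hodgecm-mathlib formalisation cell (harness21).  Prover seat hodgecm-mathlib-LH4-p04 (g9), req620 Track A «(D-RAM) FOUR-FRAME» squad
((β₂) road (R-36), β₂-BOARD v2 row (L-Σ), brick (L-Σ-3B) ED. 4-0: the d = 2 window ledger of the even row balances — pure `ℤ`-algebra on abstract cells), 2026-09-05.
-/
import Mathlib.Algebra.BigOperators.Ring.Finset
import Mathlib.Algebra.BigOperators.Intervals
import Mathlib.Tactic.LinearCombination
import Mathlib.Tactic.Ring
import Summits.HodgeConjecture.HodgeConjecture.Theorems.K2LiuSplitTwoDepthWitnessConstant   -- ★ `geom_shift`: `(q − 1)·Σ_{i<k} q^{i+1} = q^{k+1} − q` (reused, dedup)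
import HarnessLib

/-!
# Crux `H413`, line LH4 «(D-RAM) FOUR-FRAME» — (β₂) road, brick (L-Σ-3B) ED. 4-0: «THE d = 2 WINDOW LEDGER BALANCES» (pure `ℤ`-algebra, no field, no lattice)

Cell `hodgecm-mathlib` (D-0151), FLOOR 0, crux item H413 = `stmt-HodgeConjecture-24833`, route of record `HCCMUnconditional`; squad F0∕P3c∕LH4; lane
`--supports stmt-HodgeConjecture-24833 --as helper` (count-neutral).  THEOREMS ONLY (no `def`, no instance, no notation, no `sorry`, default heartbeats).
WHY.  ‹CORE.letter.v1› (binder `hcore` of ★ p863095 `row_of_core`) is, per row `2b = m` of the RamK cone ledger, the WINDOWED identity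
`Σ_{i ≤ K} X_H(b+2i, b) = Σ_{i < min (K+1) d} X_A(b+2i, b)`, `K = (jl − m)∕2`.  At the frame depth `d = 2` (δ = jl − m even, `K ≥ 2`) the β₂ sub-dealer's rows
(β₂ WORDS #16–#19) give every window cell RELATIVE to the diagonal cell `D := X_H(b,b)` — sign-free laws `n(b,b)·X(j,b) = ±λ·n(j,b)·X(b,b)` with the cell
weights `n` — and THIS FILE is the arithmetic that closes the window once those rows land: on ABSTRACT cells `X XA n nA : ℕ → ℤ` (`i ↦` the cell `c = 2i`; `n`, `nA` the
weights of the hyperbolic ∕ anisotropic literal) with hypotheses EXACTLY the dealt shapes —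
* (ROW-D×) `XA 0 = −X 0` · (ROW-REL-CLEAN, hyperbolic) `∀ i, 1 ≤ i → i + 2 ≤ K → n 0 * X i = n i * X 0` · (ROW-REL-FLIPT) `3 ≤ K → (q − 1) * n 0 * X (K − 1) = −(n (K − 1) * X 0)` ·
  (ROW-REL-B2d) `K = 2 → n 0 * X 1 = n 1 * X 0` · (ROW-TERM) `X K = 0` · (ROW-REL-CLEAN, anisotropic) `3 ≤ K → n 0 * XA 1 = nA 1 * XA 0` · (ROW-REL-S2d) `K = 2 → n 0 * XA 1 = −(nA 1 * XA 0)` ·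
  (ROW-SIZES) `n 1 = (q − 2) * n 0`, `∀ i, 2 ≤ i → i ≤ K → n i = 2 * (q − 1) * q ^ (i − 1) * n 0`, `nA 1 = q * n 0`, `n 0 ≠ 0`, with `2 ≤ q` —
it proves `Σ_{i < K+1} X i = Σ_{i < min (K+1) 2} XA i` (both sides are `(q − 1)·X 0` at `K = 2` and `−(q + 1)·X 0` at `K ≥ 3`: the ROW-LEDGER-B totals, d = 2, every even δ ≥ 4).
HONEST LABEL.  Arithmetic only; nothing printed is asserted; the rows, ‹CORE›, β₂ stay HYPOTHESES; d ≥ 4 and odd δ are NOT covered (different ledger — census first);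
`HC_CM` is proved only modulo the 7 printed citations (2 remaining named inputs: hLiu418 = `stmt-HodgeConjecture-24832`, h413 = `stmt-HodgeConjecture-24833`) until rung 0 closes.
References: [Kottwitz1986BaseChangeUnits] R. E. Kottwitz, Compositio Math. 60 (1986), §1 pp. 240–241 (cell-by-cell lattice counts) · [Rogawski1990] Ann. of Math. Stud. 123,
§4.9 Prop. 4.9.1 (b) p. 55, Lemma 4.9.3 p. 56.
-/

set_option autoImplicit false

namespace Summit.HodgeConjecture.HodgeConjecture.Cruxes.H413.F0P3cDyRamWindowLedgerTwo

open Finset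

/-! ## The d = 2 window ledger (the clean towers telescope by ★ `K2LiuSplitTwoDepthWitnessConstant.geom_shift`) -/

/-- **(L-Σ-3B) ED. 4-0 — THE d = 2 WINDOW LEDGER OF THE EVEN ROW BALANCES** (abstract cells; hypotheses = the dealt row shapes of β₂ WORDS #16–#19, see the module docstring):
`Σ_{i < K+1} X i = Σ_{i < min (K+1) 2} XA i` for every `K ≥ 2`. [cite: Kottwitz1986BaseChangeUnits, §1 pp. 240–241] [cite: Rogawski1990, §4.9 Prop. 4.9.1 (b) p. 55, Lemma 4.9.3 p. 56] -/
theorem window_ledger_two (X XA n nA : ℕ → ℤ) (q : ℤ) (K : ℕ) (hK : 2 ≤ K) (hq : 2 ≤ q) (hn0 : n 0 ≠ 0)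
    (hD : XA 0 = -X 0)
    (hclean : ∀ i, 1 ≤ i → i + 2 ≤ K → n 0 * X i = n i * X 0)
    (hflip : 3 ≤ K → (q - 1) * n 0 * X (K - 1) = -(n (K - 1) * X 0))
    (hB : K = 2 → n 0 * X 1 = n 1 * X 0)
    (hterm : X K = 0)
    (hAclean : 3 ≤ K → n 0 * XA 1 = nA 1 * XA 0)
    (hS : K = 2 → n 0 * XA 1 = -(nA 1 * XA 0))
    (hn1 : n 1 = (q - 2) * n 0) (hn : ∀ i, 2 ≤ i → i ≤ K → n i = 2 * (q - 1) * q ^ (i - 1) * n 0) (hnA : nA 1 = q * n 0) :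
    ∑ i ∈ range (K + 1), X i = ∑ i ∈ range (min (K + 1) 2), XA i := by
  have hR : ∑ i ∈ range (min (K + 1) 2), XA i = XA 0 + XA 1 := by
    rw [min_eq_right (by omega : 2 ≤ K + 1), sum_range_succ, sum_range_one]
  rw [hR]
  have hq1 : (q - 1) ≠ 0 := fun h => by omega
  -- the first tower cell `c = 2`: `X 1 = (q − 2)·X 0` (clean when `K ≥ 3`, the boundary law (B2d) when `K = 2`)
  have hX1 : X 1 = (q - 2) * X 0 := by
    have h1 : n 0 * X 1 = n 1 * X 0 := by
      rcases Nat.lt_or_ge K 3 with h | h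
      · exact hB (by omega)
      · exact hclean 1 le_rfl (by omega)
    refine mul_left_cancel₀ hn0 ?_
    rw [h1, hn1]; ring
  rcases Nat.lt_or_ge K 3 with hK2 | hK3
  · -- `K = 2` (δ = 2d = 4): window `D, B, terminal`; anisotropic `−D, S` with `S = q·D`
    obtain rfl : K = 2 := by omega
    have hXA1 : XA 1 = q * X 0 := by
      refine mul_left_cancel₀ hn0 ?_
      rw [hS rfl, hnA, hD]; ring
    rw [sum_range_succ, sum_range_succ, sum_range_succ, sum_range_zero, hterm, hX1, hXA1, hD]
    ring
  · -- `K = k + 3 ≥ 3` (δ ≥ 6): window `D, B, clean towers, flip tower, terminal`; anisotropic `−D, −q·D`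
    obtain ⟨k, rfl⟩ : ∃ k, K = k + 3 := ⟨K - 3, by omega⟩
    have hXA1 : XA 1 = -(q * X 0) := by
      refine mul_left_cancel₀ hn0 ?_
      rw [hAclean hK3, hnA, hD]; ring
    -- the flip tower `i = k + 2`
    have hXf : X (k + 2) = -(2 * q ^ (k + 1) * X 0) := by
      have hf : (q - 1) * n 0 * X (k + 3 - 1) = -(n (k + 3 - 1) * X 0) := hflip hK3
      rw [(by omega : k + 3 - 1 = k + 2), hn (k + 2) (by omega) (by omega), (by omega : k + 2 - 1 = k + 1)] at hf
      refine mul_left_cancel₀ (mul_ne_zero hq1 hn0) ?_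
      rw [hf]; ring
    -- the clean towers `2 ≤ i + 2 ≤ k + 1`
    have hXc : ∀ i ∈ range k, X (i + 1 + 1) = 2 * (q - 1) * q ^ (i + 1) * X 0 := fun i hi => by
      have hik := mem_range.1 hi
      have hc := hclean (i + 1 + 1) (by omega) (by omega)
      rw [hn (i + 1 + 1) (by omega) (by omega), Nat.add_sub_cancel] at hc
      refine mul_left_cancel₀ hn0 ?_
      rw [hc]; ring
    have hsum : ∑ i ∈ range k, X (i + 1 + 1) = 2 * X 0 * (q ^ (k + 1) - q) := by
      rw [sum_congr rfl hXc, ← Summit.HodgeConjecture.HodgeConjecture.Cruxes.HLiu418.K2LiuSplitTwoDepthWitnessConstant.geom_shift q k, mul_sum, mul_sum]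
      exact sum_congr rfl fun i _ => by ring
    -- peel the window: terminal and flip tower on top, `D` and `B` at the bottom, clean towers in between
    rw [sum_range_succ, sum_range_succ, sum_range_succ', sum_range_succ', zero_add, hsum, hterm, hXf, hX1, hXA1, hD]
    ring

end Summit.HodgeConjecture.HodgeConjecture.Cruxes.H413.F0P3cDyRamWindowLedgerTwo
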